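import Literature.NumberTheory.Automorphic.CompactGroupKFiniteVectorsPeterWeyl   -- ★ Peter–Weyl: `eq_zero_of_forall_inner_finiteVector_eq_zero`
import Literature.NumberTheory.Automorphic.UnitaryIsotypicProjection              -- ★ `Representation.homRangeSum`, `range_le_homRangeSum`, `subRep`, `orbitSpan`
import HarnessLib

/-!
# Under admissibility, an orthogonal family of closed subrepresentations in ONE unitary class is FINITE (Harish-Chandra 1953, Thm. 4: «each
# occurring with finite multiplicity»)

Topic `NumberTheory/Automorphic`; namespace `ContRepresentation` (dot-notation extensions of Mathlib's `ContRepresentation`, as ★ `HilbertRepAdmissibleDiscreteDecomposition`).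
THEOREMS ONLY (no definition, no instance, no notation, no named fact, no `sorry`).  Cell `hodgecm-mathlib`, F0∕P3, ROAD «TF» (letter #84, residual `ArchFinTraceSplit` = registered
`stub_AFS`): the FINITENESS clause «`∃ n, W : Fin n → …`» of the structure statement H3 (a) of SPEC «J2» — the companion of ★ `HilbertRepAdmissibleDiscreteDecomposition`
(existence of the orthogonal decomposition) on the road «H3 (a) ⟸ {`K`-admissibility, class isotypy} + ★».

THE STATEMENT (`ClosedSubrep.card_mul_finrank_le_of_areUnitarilyEquivalent`).  `π` a representation of `G` on the Hilbert space `H`, `ιK : K →* G`; `W₀` a closed invariant subspace and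
`E₀ ≤ W₀` a finite-dimensional `K`-stable subspace whose ISOTYPIC COMPONENT `H(E₀) := Σ_{T ∈ Hom_K(E₀, H)} im T` (★ `Representation.homRangeSum`) is finite-dimensional
(admissibility at the `K`-type `E₀`).  Then for every finite family `s` of PAIRWISE ORTHOGONAL closed invariant subspaces each unitarily equivalent to `W₀`:
`#s · dim E₀ ≤ dim H(E₀)` — the copies `e_W(E₀) ≤ W` (`e_W : W₀ ≃ W` the isometric equivalence) are pairwise orthogonal `K`-stable subspaces of dimension `dim E₀` inside `H(E₀)`
(each `v ↦ e_W v` is a `K`-map `E₀ → H`, ★ `range_le_homRangeSum`).  Consequently (`…finite_of_areUnitarilyEquivalent`) a pairwise orthogonal SET of closed subrepresentations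
unitarily equivalent to `W₀` is FINITE as soon as `E₀ ≠ ⊥`, and (`ClosedSubrep.exists_finiteDimensional_stable_ne_bot`, Peter–Weyl) a non-zero `W₀` on which `π ∘ ιK` is strongly
continuous (`K` compact Hausdorff) always contains such an `E₀`.  [HarishChandraTAMS1953, §9 Thm. 4 (p. 224) «… each occurring with finite multiplicity»]; [DeitmarEchterhoff2014,
§7.3 Thm. 7.3.2]; [BorelWallach2000, 0 §2.3].  The `K`-block count for FINITE-DIMENSIONAL `W₀` is ★ `card_mul_finrank_le_finrank_homRangeSum` (`HilbertRepEquivalentBlocksCount`);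
here `W₀` is an arbitrary (infinite-dimensional) block and only its `K`-type `E₀` is finite-dimensional.

## Mathlib ∕ tree search
Tree: ★ `HilbertRepEquivalentBlocksCount` (finite-dimensional `W₀`; pattern of `toSubmodule_le_homRangeSum_of_areUnitarilyEquivalent` reused for the copies), ★ `UnitaryIsotypicProjection`,
★ `CompactGroupKFiniteVectorsPeterWeyl.eq_zero_of_forall_inner_finiteVector_eq_zero`, ★ `HilbertRepSpectrum` (`ClosedSubrep`, `AreUnitarilyEquivalent`).  Mathlib:
`LinearMap.intertwiningMap_of_isIntertwiningMap`, `Submodule.finrank_sup_add_finrank_inf_eq`, `Submodule.IsOrtho.disjoint`, `LinearMap.finrank_range_of_inj`, `Set.Infinite.exists_subset_card_eq`.  Dedup: `rg "finite_of_areUnitarilyEquivalent|card_mul_finrank_le_of_areUnitarilyEquivalent" Literature/` — no hits.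

## References
* Harish-Chandra, *Representations of a semisimple Lie group on a Banach space. I*, Trans. AMS 75 (1953), §9 Thm. 4 (p. 224) [HarishChandraTAMS1953].
* A. Deitmar, S. Echterhoff, *Principles of Harmonic Analysis*, 2nd ed. (2014), §7.3 Thm. 7.3.2 [DeitmarEchterhoff2014].
* A. Borel, N. Wallach, *Continuous Cohomology, Discrete Subgroups, and Representations of Reductive Groups*, 2nd ed. (2000), 0 §2.3 [BorelWallach2000].
* Th. Bröcker, T. tom Dieck, *Representations of Compact Lie Groups* (1985), III Thm. (5.7) [BrockerTomDieck1985].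
-/

set_option autoImplicit false

noncomputable section

open scoped InnerProductSpace

namespace ContRepresentation

open Literature.NumberTheory.Automorphic

variable {G : Type*} [Group G] {K : Type*} [Group K]
  {H : Type*} [NormedAddCommGroup H] [InnerProductSpace ℂ H] [CompleteSpace H]
  {π : ContRepresentation ℂ G H} (ιK : K →* G)

/-! ## §1 The copy of a `K`-type inside an equivalent block -/

omit [CompleteSpace H] in
/-- **The copy `e(E₀)` of a `K`-stable `E₀ ≤ W₀` under an isometric equivalence `e : W₀ ≃ W` of closed subrepresentations lies in `W`, in the isotypic component `H(E₀)`,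
and has the dimension of `E₀`** (the map `v ↦ e v` is a `K`-map from the `K`-representation on `E₀` to `π ∘ ιK`, ★ `Representation.range_le_homRangeSum`).
[cite: DeitmarEchterhoff2014, §7.3 Thm. 7.3.2] -/
theorem ClosedSubrep.exists_copy_of_areUnitarilyEquivalent (W₀ W : ClosedSubrep π) (h : AreUnitarilyEquivalent W₀.toContRep W.toContRep)
    (E₀ : Submodule ℂ H) (hE₀W : E₀ ≤ W₀.toSubmodule) (hE₀K : ∀ k, ∀ v ∈ E₀, (π.restrict ιK) k v ∈ E₀) [FiniteDimensional ℂ E₀] :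
    ∃ F : Submodule ℂ H, F ≤ W.toSubmodule ∧
      F ≤ Representation.homRangeSum (π.restrict ιK).toRepresentation ((π.restrict ιK).subRep E₀ hE₀K) ∧
      FiniteDimensional ℂ F ∧ Module.finrank ℂ F = Module.finrank ℂ E₀ := by
  obtain ⟨e, -⟩ := h
  -- the linear map `f : E₀ → H`, `v ↦ e v`
  let f : E₀ →ₗ[ℂ] H := W.toSubmodule.subtype ∘ₗ (e.toContinuousLinearEquiv.toLinearEquiv : W₀.toSubmodule →ₗ[ℂ] W.toSubmodule) ∘ₗ
    Submodule.inclusion hE₀W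
  have hf : ∀ v : E₀, f v = ((e ⟨(v : H), hE₀W v.2⟩ : W.toSubmodule) : H) := fun v => rfl
  have hfK : ∀ (k : K) (v : E₀), f (((π.restrict ιK).subRep E₀ hE₀K) k v) = ContRepresentation.toRepresentation ℂ K H (π.restrict ιK) k (f v) := by
    intro k v
    rw [hf, hf]
    change ((e ⟨π (ιK k) (v : H), _⟩ : W.toSubmodule) : H) = π (ιK k) ((e ⟨(v : H), hE₀W v.2⟩ : W.toSubmodule) : H)
    have h1 : (⟨π (ιK k) (v : H), W₀.apply_mem (ιK k) (hE₀W v.2)⟩ : W₀.toSubmodule) = W₀.toContRep (ιK k) ⟨(v : H), hE₀W v.2⟩ :=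
      Subtype.ext (ClosedSubrep.coe_toContRep_apply W₀ (ιK k) ⟨(v : H), hE₀W v.2⟩).symm
    rw [h1, show e (W₀.toContRep (ιK k) ⟨(v : H), hE₀W v.2⟩) = W.toContRep (ιK k) (e ⟨(v : H), hE₀W v.2⟩) from
      e.toContIntertwiningMap.isIntertwining (ιK k) _, ClosedSubrep.coe_toContRep_apply]
  let j : ((π.restrict ιK).subRep E₀ hE₀K).IntertwiningMap (ContRepresentation.toRepresentation ℂ K H (π.restrict ιK)) :=
    LinearMap.intertwiningMap_of_isIntertwiningMap _ _ f hfK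
  have hinj : Function.Injective f := fun v w hvw => by
    rw [hf, hf] at hvw
    have h2 := e.toContinuousLinearEquiv.injective (Subtype.ext hvw)
    exact Subtype.ext (congrArg (fun z : W₀.toSubmodule => (z : H)) h2)
  refine ⟨LinearMap.range f, ?_, Representation.range_le_homRangeSum j, inferInstance, LinearMap.finrank_range_of_inj hinj⟩
  rintro _ ⟨v, rfl⟩
  rw [hf]
  exact (e ⟨(v : H), hE₀W v.2⟩).2

/-! ## §2 The count -/

omit [CompleteSpace H] in
/-- Dimension of a finite supremum of pairwise orthogonal subspaces of equal dimension `d`: `= #s · d` (private arithmetic∕lattice plumbing). [folklore] -/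
private theorem finrank_biSup_eq_card_mul_submodule {ι : Type*} (F : ι → Submodule ℂ H) {d : ℕ} (s : Finset ι) (hfd : ∀ i ∈ s, FiniteDimensional ℂ (F i))
    (hd : ∀ i ∈ s, Module.finrank ℂ (F i) = d) (ho : ∀ i ∈ s, ∀ j ∈ s, i ≠ j → F i ⟂ F j) :
    FiniteDimensional ℂ (⨆ i ∈ s, F i : Submodule ℂ H) ∧ Module.finrank ℂ (⨆ i ∈ s, F i : Submodule ℂ H) = s.card * d := by
  classical
  induction s using Finset.induction_on with
  | empty =>
    have h0 : (⨆ i ∈ (∅ : Finset ι), F i : Submodule ℂ H) = ⊥ := by simp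
    rw [h0, Finset.card_empty, zero_mul, finrank_bot]
    exact ⟨inferInstance, rfl⟩
  | insert a s ha ih =>
    obtain ⟨hfin, hdim⟩ := ih (fun i hi => hfd i (Finset.mem_insert_of_mem hi)) (fun i hi => hd i (Finset.mem_insert_of_mem hi))
      (fun i hi j hj hij => ho i (Finset.mem_insert_of_mem hi) j (Finset.mem_insert_of_mem hj) hij)
    haveI := hfin
    haveI := hfd a (Finset.mem_insert_self a s)
    have hsup : (⨆ i ∈ insert a s, F i : Submodule ℂ H) = F a ⊔ ⨆ i ∈ s, F i := by
      rw [Finset.iSup_insert]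
    -- `F a ⟂ ⨆ i ∈ s, F i`
    have horth : F a ⟂ (⨆ i ∈ s, F i : Submodule ℂ H) := by
      refine Submodule.IsOrtho.symm ((Submodule.isOrtho_iSup_left).2 fun i => (Submodule.isOrtho_iSup_left).2 fun hi => ?_)
      exact (ho a (Finset.mem_insert_self a s) i (Finset.mem_insert_of_mem hi) (fun h => ha (h ▸ hi))).symm
    have hinf : F a ⊓ (⨆ i ∈ s, F i : Submodule ℂ H) = ⊥ := horth.disjoint.eq_bot
    rw [hsup]
    refine ⟨inferInstance, ?_⟩
    have h := Submodule.finrank_sup_add_finrank_inf_eq (F a) (⨆ i ∈ s, F i : Submodule ℂ H)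
    rw [hinf, finrank_bot, add_zero, hdim, hd a (Finset.mem_insert_self a s), Finset.card_insert_of_notMem ha] at *
    rw [h]
    ring

omit [CompleteSpace H] in
/-- **`#s · dim E₀ ≤ dim H(E₀)`** for a finite pairwise orthogonal family `s` of closed subrepresentations unitarily equivalent to `W₀ ⊇ E₀` (`E₀` a finite-dimensional `K`-stable
subspace with finite-dimensional isotypic component). [cite: HarishChandraTAMS1953, §9 Thm. 4 (p. 224)] [cite: DeitmarEchterhoff2014, §7.3 Thm. 7.3.2] -/
theorem ClosedSubrep.card_mul_finrank_le_of_areUnitarilyEquivalent (W₀ : ClosedSubrep π) (s : Finset (ClosedSubrep π))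
    (hs : ∀ W ∈ s, AreUnitarilyEquivalent W₀.toContRep W.toContRep) (ho : (s : Set (ClosedSubrep π)).Pairwise fun W W' => W.toSubmodule ⟂ W'.toSubmodule)
    (E₀ : Submodule ℂ H) (hE₀W : E₀ ≤ W₀.toSubmodule) (hE₀K : ∀ k, ∀ v ∈ E₀, (π.restrict ιK) k v ∈ E₀) [FiniteDimensional ℂ E₀]
    [FiniteDimensional ℂ (Representation.homRangeSum (π.restrict ιK).toRepresentation ((π.restrict ιK).subRep E₀ hE₀K))] :
    s.card * Module.finrank ℂ E₀ ≤ Module.finrank ℂ (Representation.homRangeSum (π.restrict ιK).toRepresentation ((π.restrict ιK).subRep E₀ hE₀K)) := by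
  classical
  choose! F hFW hFiso hFfd hFd using fun W (hW : W ∈ s) => W₀.exists_copy_of_areUnitarilyEquivalent ιK W (hs W hW) E₀ hE₀W hE₀K
  have ho' : ∀ W ∈ s, ∀ W' ∈ s, W ≠ W' → F W ⟂ F W' := fun W hW W' hW' hne =>
    (ho hW hW' hne).mono (hFW W hW) (hFW W' hW')
  obtain ⟨hfin, hdim⟩ := finrank_biSup_eq_card_mul_submodule F s hFfd hFd ho'
  haveI := hfin
  rw [← hdim]
  exact Submodule.finrank_mono (iSup₂_le fun W hW => hFiso W hW)

omit [CompleteSpace H] in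
/-- **FINITENESS**: a pairwise orthogonal SET of closed subrepresentations each unitarily equivalent to `W₀` is FINITE, of size `≤ dim H(E₀) / dim E₀`, as soon as `W₀` contains a non-zero
finite-dimensional `K`-stable `E₀` with finite-dimensional isotypic component («each irreducible occurs with finite multiplicity»). [cite: HarishChandraTAMS1953, §9 Thm. 4 (p. 224)]
[cite: BorelWallach2000, 0 §2.3] -/
theorem ClosedSubrep.finite_of_areUnitarilyEquivalent (W₀ : ClosedSubrep π) {S : Set (ClosedSubrep π)}
    (hS : ∀ W ∈ S, AreUnitarilyEquivalent W₀.toContRep W.toContRep) (ho : S.Pairwise fun W W' => W.toSubmodule ⟂ W'.toSubmodule)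
    (E₀ : Submodule ℂ H) (hE₀W : E₀ ≤ W₀.toSubmodule) (hE₀K : ∀ k, ∀ v ∈ E₀, (π.restrict ιK) k v ∈ E₀) [FiniteDimensional ℂ E₀] (hE₀ : E₀ ≠ ⊥)
    [FiniteDimensional ℂ (Representation.homRangeSum (π.restrict ιK).toRepresentation ((π.restrict ιK).subRep E₀ hE₀K))] :
    S.Finite ∧ S.ncard * Module.finrank ℂ E₀ ≤
      Module.finrank ℂ (Representation.homRangeSum (π.restrict ιK).toRepresentation ((π.restrict ιK).subRep E₀ hE₀K)) := by
  classical
  set D := Module.finrank ℂ (Representation.homRangeSum (π.restrict ιK).toRepresentation ((π.restrict ιK).subRep E₀ hE₀K)) with hD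
  have hd : 0 < Module.finrank ℂ E₀ := by
    rw [pos_iff_ne_zero, Ne, Submodule.finrank_eq_zero]
    exact hE₀
  have hbound : ∀ t : Finset (ClosedSubrep π), ↑t ⊆ S → t.card * Module.finrank ℂ E₀ ≤ D := fun t ht =>
    W₀.card_mul_finrank_le_of_areUnitarilyEquivalent ιK t (fun W hW => hS W (ht hW)) (ho.mono ht) E₀ hE₀W hE₀K
  have hfin : S.Finite := by
    by_contra hinf
    obtain ⟨t, htS, htc⟩ := Set.Infinite.exists_subset_card_eq hinf (D + 1)
    have h := hbound t htS
    rw [htc] at h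
    nlinarith
  refine ⟨hfin, ?_⟩
  have h := hbound hfin.toFinset (by simp)
  rwa [Set.ncard_eq_toFinset_card S hfin]

/-! ## §3 A non-zero block contains a non-zero finite-dimensional `K`-type (Peter–Weyl) -/

variable [TopologicalSpace K] [IsTopologicalGroup K] [CompactSpace K] [T2Space K]

/-- **A non-zero closed subrepresentation on which `π ∘ ιK` is strongly continuous (`π` unitary, `K` compact Hausdorff) contains a non-zero finite-dimensional `K`-stable subspace**:
some `K`-finite vector of the block is non-zero (Peter–Weyl ★ `eq_zero_of_forall_inner_finiteVector_eq_zero` on the block), and the span of its `K`-orbit will do.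
[cite: BrockerTomDieck1985, III Thm (5.7)] [cite: HarishChandraTAMS1953, §9 Thm. 4 (p. 224)] -/
theorem ClosedSubrep.exists_finiteDimensional_stable_ne_bot (hπ : π.IsUnitary) (hc : (π.restrict ιK).IsStronglyContinuous)
    (W₀ : ClosedSubrep π) (hW₀ : W₀ ≠ ⊥) :
    ∃ E₀ : Submodule ℂ H, E₀ ≤ W₀.toSubmodule ∧ (∀ k, ∀ v ∈ E₀, (π.restrict ιK) k v ∈ E₀) ∧ FiniteDimensional ℂ E₀ ∧ E₀ ≠ ⊥ := by
  -- the block representation restricted to `K`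
  let σ₀ : ContRepresentation ℂ K W₀.toSubmodule := W₀.toContRep.restrict ιK
  have hσ₀u : σ₀.IsUnitary := fun k => (hπ.toContRep W₀) (ιK k)
  have hσ₀c : σ₀.IsStronglyContinuous := fun v => by
    have h1 : Continuous fun k : K => ((W₀.toContRep (ιK k) v : W₀.toSubmodule) : H) := by
      simp only [ClosedSubrep.coe_toContRep_apply]
      exact hc (v : H)
    exact continuous_induced_rng.2 h1
  -- a non-zero `K`-finite vector of the block
  obtain ⟨w, hw⟩ := ClosedSubrep.exists_mem_ne_zero_of_ne_bot hW₀
  have : ∃ u : W₀.toSubmodule, FiniteDimensional ℂ (σ₀.orbitSpan u) ∧ u ≠ 0 := by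
    by_contra hnone
    push Not at hnone
    have h0 : (⟨w, hw.1⟩ : W₀.toSubmodule) = 0 :=
      eq_zero_of_forall_inner_finiteVector_eq_zero (π := σ₀) hσ₀c hσ₀u fun u hu => by rw [hnone u hu, inner_zero_left]
    exact hw.2 (congrArg Subtype.val h0)
  obtain ⟨u, hu, hu0⟩ := this
  haveI := hu
  refine ⟨(σ₀.orbitSpan u).map W₀.toSubmodule.subtype, ?_, ?_, inferInstance, ?_⟩
  · rintro _ ⟨x, -, rfl⟩
    exact x.2
  · rintro k _ ⟨x, hx, rfl⟩
    refine ⟨σ₀ k x, σ₀.apply_mem_orbitSpan_of_mem k hx, ?_⟩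
    exact ClosedSubrep.coe_toContRep_apply W₀ (ιK k) x
  · intro h
    apply hu0
    have hmem : (W₀.toSubmodule.subtype u) ∈ (σ₀.orbitSpan u).map W₀.toSubmodule.subtype := ⟨u, σ₀.mem_orbitSpan_self u, rfl⟩
    rw [h, Submodule.mem_bot] at hmem
    exact Subtype.ext hmem

end ContRepresentation

end
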